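import Mathlib
import HarnessLib
import Summits.AnomalousDissipation.AnomalousDissipation.Theses.DecimationAxis

/-!
# Route `DecimationAxis`, crux `UniformEquilibration` (stmt-AnomalousDissipation-1583):
# vocabulary and registered stub statements of the line `birth`

`Defs` file (D-0016 `<Route>Defs` convention; precedents `BECThomsonPrincipleGDTransferDefs.lean`,
`MomentParityDefs.lean`) of the crux skeleton
`Summits/AnomalousDissipation/AnomalousDissipation/Cruxes/UniformEquilibration/Lines/birth.lean`
(sha 6127c29d…, registrar planner-skel-stmt-AnomalousDissipation-1583-0, three registered stubs
`stub_absorbedWitness`, `stub_uniformSettling`, `stub_tameRestart`). A `Cruxes/…/Lines/*.lean`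
skeleton is not an importable module, so the vocabulary the line posits and the STATEMENTS of its
registered stubs live here — copied VERBATIM from the skeleton (same namespace
`Summit.AnomalousDissipation.AnomalousDissipation.Cruxes.UniformEquilibration.Birth`, same names;
only the local notations `ℤ³ := Fin 3 → ℤ`, `ℂ³ := EuclideanSpace ℂ (Fin 3)` are expanded) —
to be imported by the stub files `Theorems/DecimationAxisUniformEquilibration<Stub>.lean`
(landed `--supports stmt-AnomalousDissipation-1583`) and by the closing composition; the skeleton is
re-pointed by importing this module and deleting its local copies (zero renaming).

Nothing open is asserted: every `def … : Prop` is a statement (a registered stub signature or the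
crux's own solution notion), consumed only as the type of a stub theorem or as an explicit
hypothesis; the one theorem proved here, `UniformEquilibration_of`, is the sorry-free composition
`Sig.stub_absorbedWitness → Sig.stub_uniformSettling → Sig.stub_tameRestart → UniformEquilibration`
(the crux BY NAME), pure bookkeeping.

Contents:
* §0 vocabulary naming the crux's own lambda terms — `IsCoeffTrajectory` (global trajectory of the
  exact-coupling Galerkin system `galerkinRHS S ν g↾S`, = `IsGalerkinODESolution` minus its `rfl`
  datum clause), `modalEnergy` (`Σ‖a_k‖²`), `resolvedDissipation` (`ν·4π²·Σ_{|k|≤M}|k|²‖a_k‖²`),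
  `h1Size` (`Σ(1+|k|²)‖a_k‖²`);
* §1 the three registered signatures `Sig.stub_absorbedWitness`, `Sig.stub_uniformSettling`,
  `Sig.stub_tameRestart` (docstrings = the skeleton's, with the intended proofs and sources);
* §2 `UniformEquilibration_of`.

Deliberately NOT here: any proof of a stub (separate files, one per stub), the sorried `stub_*`
placeholders and `UniformEquilibration_proof` of the skeleton (they stay under `Cruxes/`).
Sources: FoiasManleyRosaTemam2001 Ch. II, IV; ConstantinFoias1988 Ch. 8; DoeringFoias2002 §2;
RobinsonRodrigoSadowski2016 Thm 4.4.
-/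

-- every `Summit.AnomalousDissipation.AnomalousDissipation.…` name repeats the summit = sub-problem
-- segment (D-0017 layout)
set_option linter.dupNamespace false

noncomputable section

namespace Summit.AnomalousDissipation.AnomalousDissipation.Cruxes.UniformEquilibration.Birth

open scoped BigOperators Topology Classical MeasureTheory InnerProductSpace ComplexConjugate
open Filter Set Function MeasureTheory
open Literature.Analysis.FunctionSpaces Literature.Analysis.FunctionSpaces.Torus
open Literature.Analysis.FluidPDE
open Summit.AnomalousDissipation.AnomalousDissipation.Theses.DecimationAxis

/-! ### §0 Vocabulary of the seam (plain `def`s naming the crux's own lambda terms) -/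

/-- `IsCoeffTrajectory S ν g c`: the crux's solution notion, verbatim — a global trajectory of the
exact-coupling Galerkin system on `S` at viscosity `ν` driven by `g↾S`: values in the Galerkin phase
space, continuous on `[0, ∞)`, solving `ċ = galerkinRHS S ν g↾S c` on every `[0, T]` (one-sided
derivatives at the endpoints). Equivalently `IsGalerkinODESolution ν (g↾S) (c 0) c` (tree,
`GalerkinFlow.lean`) minus its `rfl` datum clause. -/
def IsCoeffTrajectory (S : Finset (Fin 3 → ℤ)) (ν : ℝ) (g : (Fin 3 → ℤ) → EuclideanSpace ℂ (Fin 3))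
    (c : ℝ → ↥S → EuclideanSpace ℂ (Fin 3)) : Prop :=
  (∀ t, c t ∈ galerkinSubspace S) ∧ ContinuousOn c (Set.Ici 0) ∧
    ∀ T : ℝ, ∀ t ∈ Set.Icc (0 : ℝ) T,
      HasDerivWithinAt c (galerkinRHS S ν (fun k => g k) (c t)) (Set.Icc 0 T) t

/-- Modal energy `Σ_{k∈S} ‖a_k‖²` (`= ∫‖u‖²` for `u = realTrigPoly S ā`; the crux's energy
observable, verbatim). -/
def modalEnergy {S : Finset (Fin 3 → ℤ)} (a : ↥S → EuclideanSpace ℂ (Fin 3)) : ℝ :=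
  ∑ k : ↥S, ‖a k‖ ^ 2

/-- Resolved dissipation below wavenumber `M` at viscosity `ν`: `ν·4π²·Σ_{|k|≤M} |k|²‖a_k‖²`
(the crux's dissipation observable, verbatim). -/
def resolvedDissipation {S : Finset (Fin 3 → ℤ)} (ν : ℝ) (M : ℕ)
    (a : ↥S → EuclideanSpace ℂ (Fin 3)) : ℝ :=
  ν * (4 * Real.pi ^ 2 * ∑ k : ↥S,
    if freqNormSq (k : Fin 3 → ℤ) ≤ (M : ℝ) ^ 2 then freqNormSq (k : Fin 3 → ℤ) * ‖a k‖ ^ 2 else 0)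

/-- The `H¹`-type size of a datum, `Σ_{k∈S} (1+|k|²)‖a_k‖²` (the crux's datum clause, verbatim). -/
def h1Size {S : Finset (Fin 3 → ℤ)} (a : ↥S → EuclideanSpace ℂ (Fin 3)) : ℝ :=
  ∑ k : ↥S, (1 + freqNormSq (k : Fin 3 → ℤ)) * ‖a k‖ ^ 2

/-! ### §1 Stub signatures (`Sig.stub_*`, so that the hypothesis heads of `UniformEquilibration_of`
carry the registered stub names) -/

/-- STUB 1 — THE FLOOR WITNESS MAY BE TAKEN INSIDE THE `K`-UNIFORM ABSORBING BALL (provable now, M).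
For `ν > 0` and an admissible force family `g` (the crux's four hypotheses) there is ONE `B` such that
for all `E ε M K` and `S = freqBall K ∖ {0}`: a trajectory with `longTimeAvgSup` energy `≤ E` and
`longTimeAvgInf` resolved dissipation `≥ 2ε` can be replaced by one with the same two asymptotic
bounds which stays in the energy ball `Σ‖c(t)_k‖² ≤ B` for all `t ≥ 0`. Intended proof: absorbing
ball `B = (G_N/(4π²ν))² + 1`, `G_N² = Σ_{k ∈ freqBall N}‖g k‖²` (energy inequality
`ė ≤ −8π²ν e + 2G_N√e` from `hasDerivWithinAt_energy` and Poincaré `|k|² ≥ 1` on `S ∌ 0`), entered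
in finite time and forward invariant; time shift to the entrance time
(`IsGalerkinODESolution.comp_add`); shift invariance of `longTimeAvgSup`/`longTimeAvgInf` of
nonnegative locally integrable observables (`longTimeAvgSup_comp_add_right` and its `liminf` twin).
Sources: ConstantinFoias1988 Ch. 8 (8.7)–(8.9); Temam1997 Ch. III §2.2; DoeringFoias2002 §2. -/
def Sig.stub_absorbedWitness : Prop :=
  ∀ (ν : ℝ), 0 < ν → ∀ (N : ℕ) (g : (Fin 3 → ℤ) → EuclideanSpace ℂ (Fin 3)), IsConjSymm g →
    (∀ k, k ∉ freqBall N → g k = 0) →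
    g 0 = 0 → (∀ k : Fin 3 → ℤ, ∑ i, ((k i : ℤ) : ℂ) * g k i = 0) →
    ∃ B : ℝ, ∀ (E ε : ℝ) (M K : ℕ) (S : Finset (Fin 3 → ℤ)), S = (freqBall K).erase 0 →
      (∃ c : ℝ → ↥S → EuclideanSpace ℂ (Fin 3), IsCoeffTrajectory S ν g c ∧
          longTimeAvgSup (fun t => modalEnergy (c t)) ≤ E ∧
          2 * ε ≤ longTimeAvgInf (fun t => resolvedDissipation ν M (c t))) →
      ∃ c : ℝ → ↥S → EuclideanSpace ℂ (Fin 3), IsCoeffTrajectory S ν g c ∧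
          (∀ t, 0 ≤ t → modalEnergy (c t) ≤ B) ∧
          longTimeAvgSup (fun t => modalEnergy (c t)) ≤ E ∧
          2 * ε ≤ longTimeAvgInf (fun t => resolvedDissipation ν M (c t))

/-- STUB 2 — `K`-UNIFORM TWO-SIDED SETTLING INSIDE THE BALL (THE RESIDUE; open, XL, load-bearing).
For `ν > 0`, admissible `g`, budgets `E`, `ε > 0`, resolution `M` and a radius `B` there are a settling
time `T₁`, margins `E₁ < 2E`, `ε₁ > ε` and a radius `B₁`, INDEPENDENT OF THE TRUNCATION, such that for
every `K`, `S = freqBall K ∖ {0}`: if some trajectory staying in the ball `B` has `longTimeAvgSup`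
energy `≤ E` and `longTimeAvgInf` resolved dissipation `≥ 2ε`, then some trajectory staying in the
ball `B₁` has `timeMean energy ≤ E₁` and `timeMean resolved dissipation ≥ ε₁` for ALL `T ≥ T₁`.
Per `K` trivial (the premise trajectory itself settles to within any margin of `(E, 2ε)`); the
content is the `K`-uniformity of `T₁` — the dynamical heart of the crux, in the two-scalar normal
form of the route reviews (rising-sun/argmin selection makes the dissipation side `T₁`-free, so what
remains is a `K`-uniform bound on the energy settling time and on the argmin `s*` of the dissipation
deficit of SOME witness). Why it might fail: near-heteroclinic cycling with passage times growing in
`K`, or slow relaxation at `k ∼ K`, forcing `T₁(K) → ∞` for every witness. Sources: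
FoiasManleyRosaTemam2001 Ch. IV; DoeringFoias2002 §2; HolmesLumleyBerkoozRowley2012 §9.2
(doi:10.1017/cbo9780511919701); KanedaEtAl2003; stmt-AnomalousDissipation-0215; cards
hyperfinite-hull-one-loeb-measure (N3), cycling-loophole-rate-vs-level. -/
def Sig.stub_uniformSettling : Prop :=
  ∀ (ν : ℝ), 0 < ν → ∀ (N : ℕ) (g : (Fin 3 → ℤ) → EuclideanSpace ℂ (Fin 3)), IsConjSymm g →
    (∀ k, k ∉ freqBall N → g k = 0) →
    g 0 = 0 → (∀ k : Fin 3 → ℤ, ∑ i, ((k i : ℤ) : ℂ) * g k i = 0) →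
    ∀ (E ε : ℝ) (M : ℕ) (B : ℝ), 0 < ε →
      ∃ (T₁ E₁ ε₁ B₁ : ℝ), E₁ < 2 * E ∧ ε < ε₁ ∧
        ∀ (K : ℕ) (S : Finset (Fin 3 → ℤ)), S = (freqBall K).erase 0 →
          (∃ c : ℝ → ↥S → EuclideanSpace ℂ (Fin 3), IsCoeffTrajectory S ν g c ∧
              (∀ t, 0 ≤ t → modalEnergy (c t) ≤ B) ∧
              longTimeAvgSup (fun t => modalEnergy (c t)) ≤ E ∧
              2 * ε ≤ longTimeAvgInf (fun t => resolvedDissipation ν M (c t))) →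
          ∃ c : ℝ → ↥S → EuclideanSpace ℂ (Fin 3), IsCoeffTrajectory S ν g c ∧
              (∀ t, 0 ≤ t → modalEnergy (c t) ≤ B₁) ∧
              ∀ T : ℝ, T₁ ≤ T →
                timeMean (fun t => modalEnergy (c t)) T ≤ E₁ ∧
                ε₁ ≤ timeMean (fun t => resolvedDissipation ν M (c t)) T

/-- STUB 3 — A TAME RESTART COSTS ONLY THE MARGINS (provable now, M). For `ν > 0`, admissible `g`,
`E`, `ε > 0`, `M` and any `(T₁, E₁, ε₁, B₁)` with `E₁ < 2E`, `ε < ε₁` there are `T₀`, `R` — depending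
on these data and on `G_N² = Σ_{freqBall N}‖g k‖²`, NOT on `K` — such that for every `K`,
`S = freqBall K ∖ {0}`: a trajectory in the ball `B₁` whose running means obey `(E₁, ε₁)` from `T₁` on
yields a trajectory from a datum with `Σ(1+|k|²)‖c(0)_k‖² ≤ R` whose running means obey `(2E, ε)`
from `T₀` on. Intended proof: energy identity on `[0, 1]` (`galerkin_energy_identity`,
`toReal_eGradNormSq_coeffExt`) bounds `4π²ν∫₀¹Σ|k|²‖c_k‖² ≤ B₁/2 + G_N√B₁`, so some `s ∈ [0,1]` is
tame, `R := B₁ + (B₁/2 + G_N√B₁)/(4π²ν)`; restart at `s` (`IsGalerkinODESolution.comp_add`); the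
restarted means differ from the old ones by at most `E₁/T` resp. `D_max/T`, `D_max = 4π²νM²B₁`
(`timeMean_comp_add_right`), absorbed by the margins for
`T ≥ T₀ := max T₁ 0 + 1 + E₁⁺/(2E − E₁) + D_max/(ε₁ − ε)`. Degenerate data (`E₁ < 0`, `B₁ < 0`,
`T₁ ≤ 0`) make the hypothesis unsatisfiable. Sources: RobinsonRodrigoSadowski2016 Thm 4.4 (4.6)–(4.7);
FoiasManleyRosaTemam2001 Ch. II (7.16)–(7.17) (restart at a positive time to gain an `H¹` datum);
tree `LongTimeAverageShift.lean`. -/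
def Sig.stub_tameRestart : Prop :=
  ∀ (ν : ℝ), 0 < ν → ∀ (N : ℕ) (g : (Fin 3 → ℤ) → EuclideanSpace ℂ (Fin 3)), IsConjSymm g →
    (∀ k, k ∉ freqBall N → g k = 0) →
    g 0 = 0 → (∀ k : Fin 3 → ℤ, ∑ i, ((k i : ℤ) : ℂ) * g k i = 0) →
    ∀ (E ε : ℝ) (M : ℕ), 0 < ε → ∀ (T₁ E₁ ε₁ B₁ : ℝ), E₁ < 2 * E → ε < ε₁ →
      ∃ (T₀ R : ℝ), ∀ (K : ℕ) (S : Finset (Fin 3 → ℤ)), S = (freqBall K).erase 0 →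
        (∃ c : ℝ → ↥S → EuclideanSpace ℂ (Fin 3), IsCoeffTrajectory S ν g c ∧
            (∀ t, 0 ≤ t → modalEnergy (c t) ≤ B₁) ∧
            ∀ T : ℝ, T₁ ≤ T →
              timeMean (fun t => modalEnergy (c t)) T ≤ E₁ ∧
              ε₁ ≤ timeMean (fun t => resolvedDissipation ν M (c t)) T) →
        ∃ c : ℝ → ↥S → EuclideanSpace ℂ (Fin 3), IsCoeffTrajectory S ν g c ∧ h1Size (c 0) ≤ R ∧
            ∀ T : ℝ, T₀ ≤ T →
              timeMean (fun t => modalEnergy (c t)) T ≤ 2 * E ∧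
              ε ≤ timeMean (fun t => resolvedDissipation ν M (c t)) T

/-! ### §2 Composition (verbatim from the skeleton's §3) -/

/-- **The line closes the crux BY NAME modulo the three registered stubs.** Fix the crux's data
`(ν, N, g, E, ε, M)`; stub 1 gives the `K`-uniform ball `B`; stub 2 at `(E, ε, M, B)` gives the
`K`-uniform settling data `(T₁, E₁, ε₁, B₁)` with `E₁ < 2E`, `ε < ε₁`; stub 3 at those gives
`(T₀, R)`. For any `K`, `S` the crux premise is (after naming its lambda terms) the premise of stub 1,
whose output feeds stub 2, whose output feeds stub 3, whose output is the crux's conclusion verbatim.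
[bookkeeping] -/
theorem UniformEquilibration_of :
    Sig.stub_absorbedWitness → Sig.stub_uniformSettling → Sig.stub_tameRestart →
      Summit.AnomalousDissipation.AnomalousDissipation.Theses.DecimationAxis.UniformEquilibration := by
  intro h₁ h₂ h₃
  dsimp only [Summit.AnomalousDissipation.AnomalousDissipation.Theses.DecimationAxis.UniformEquilibration]
  intro ν hν N g hcs hsupp hg0 htr E ε M hε
  obtain ⟨B, hball⟩ := h₁ ν hν N g hcs hsupp hg0 htr
  obtain ⟨T₁, E₁, ε₁, B₁, hE₁, hε₁, hsettle⟩ := h₂ ν hν N g hcs hsupp hg0 htr E ε M B hε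
  obtain ⟨T₀, R, hrestart⟩ := h₃ ν hν N g hcs hsupp hg0 htr E ε M hε T₁ E₁ ε₁ B₁ hE₁ hε₁
  refine ⟨T₀, R, fun K S hS hprem => ?_⟩
  obtain ⟨c, hmem, hcont, hderiv, hsup, hinf⟩ := hprem
  obtain ⟨c', ⟨hmem', hcont', hderiv'⟩, hR', hmeans'⟩ :=
    hrestart K S hS (hsettle K S hS (hball E ε M K S hS ⟨c, ⟨hmem, hcont, hderiv⟩, hsup, hinf⟩))
  exact ⟨c', hmem', hcont', hderiv', hR', hmeans'⟩

end Summit.AnomalousDissipation.AnomalousDissipation.Cruxes.UniformEquilibration.Birth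

end
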